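import Summits.QuantumFields.YangMills.Theorems.ColdStartUniversalityLatticeLangevinStochasticContinuityFlow
import Summits.QuantumFields.YangMills.Theorems.ColdStartUniversalityLatticeLangevinRegularFlow
import Summits.QuantumFields.YangMills.Theorems.ColdStartUniversalityLatticeLangevinLawUniqueStart
import Mathlib.MeasureTheory.Function.L2Space
import HarnessLib

/-!
# Route `ColdStartUniversality`, crux K_A2 `ColdStartContinuumCauchy` (stmt-QuantumFields-24810), LINE 3 «lindeberg_swap»:
# STOCHASTIC CONTINUITY OF THE SU(2) LATTICE LANGEVIN (SZZ) DYNAMICS, II: uniformly in the start and the realisation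

Helper file, part II of II (seat `ym-line-csu-p1`, g9; `--supports stmt-QuantumFields-24810`); part I
(`…LatticeLangevinStochasticContinuityFlow`) is the coordinate increment lemma `integral_coordIncr_sq_le_flow`.  Input (c) of the rung analysis
`rung-shortWindowSwap-wall.md` (evidence #18 on the crux): for the Shen–Zhu–Zhu system on `SU(2)^E`, `E = Edge 3 L`, at any
coupling `β`, there is `C = C(L, β)` such that

* along the regular solution flow `U` (every probability space, progressive clause of `exists_regularFlow`), every real link
  coordinate has increments with `E[(X_v − X_u)²] ≤ C((v−u)² + (v−u))` (`integral_coordIncr_sq_le_flow`) and the squared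
  Hilbert–Schmidt «distance» satisfies `E[Σ_e ‖ρ(U^x_v e) − ρ(U^x_u e)‖_F²] ≤ C((v−u)² + (v−u))` (`integral_hsDist_le_flow`),
  for ALL starts `x` and lattice times `u ≤ v`;
* for EVERY solution `U` from a deterministic start `x` on ANY probability space with any flat Brownian driver,
  `E[Σ_e ‖ρ(U_h e) − ρ(x e)‖_F²] ≤ C(h² + h)` (`integral_hsDist_start_le`) and, by Markov's inequality,
  `P(Σ_e ‖ρ(U_h e) − ρ(x e)‖_F² ≥ r) ≤ C(h² + h)/r` (`measureReal_hsDist_start_ge_le`) — uniform-in-start stochastic continuity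
  of THE transition kernels of the dynamics.

Proof: the increment-moment lemma for Itô processes with bounded coefficients (`incr_moments`, joint raw filtration of the
flattened driver) instantiated on the real coordinates of the regular flow exactly as in `dynkin_expectation_szz`
(coefficient bounds `exists_bound_coeff`, progressivity along the flow `isStronglyProgressive_comp_flow`, the coordinate
integral equations = Re/Im of `IsSolution.exists_ito`, zero Itô integrals for the other links), the identity
`‖ρ(a) − ρ(b)‖_F² = Σ_{ij} (Re² + Im²)` (`hsForm_self`), and transfer to arbitrary realisations by uniqueness in law from a
deterministic start (`lawUnique_of_start`) through the regular flow on the product Wiener space (`exists_regularFlow`,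
`isFlatBrownian_piWiener`).  THEOREMS ONLY, no definition, no sorry.  RECORD-rung R3 plumbing for LINE 3 (its rung as typed
needs more, see the memo); no crux, rung or summit is proved; the Yang–Mills mass gap is NOT proved.
-/

set_option autoImplicit false

noncomputable section

namespace Summit.QuantumFields.YangMills.Theorems.ColdStartUniversality

open MeasureTheory ProbabilityTheory Finset
open scoped NNReal ENNReal
open Literature.Probability.Process Literature.MathematicalPhysics.QuantumFieldTheory
open Literature.MathematicalPhysics.QuantumLattice (fundamentalRep fundamentalLatticeRep continuous_fundamentalRep)

/-- The squared Hilbert–Schmidt «distance» of two `SU(2)` configurations is the sum of the squared real coordinates of the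
entry differences: `Σ_e ‖ρ(a e) − ρ(b e)‖_F² = Σ_e Σ_{ij} ((Re)² + (Im)²)`. [folklore] -/
theorem hsDist_eq_sum_coord_sq {L : ℕ} [NeZero L] (a b : GaugeConfig 3 L (Matrix.specialUnitaryGroup (Fin 2) ℂ)) :
    (∑ e, hsForm 2 ((fundamentalRep (Fin 2) (a e) : Matrix (Fin 2) (Fin 2) ℂ) - fundamentalRep (Fin 2) (b e))
        ((fundamentalRep (Fin 2) (a e) : Matrix (Fin 2) (Fin 2) ℂ) - fundamentalRep (Fin 2) (b e))) =
      ∑ e, ∑ i, ∑ j,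
        ((((fundamentalRep (Fin 2) (a e) : Matrix (Fin 2) (Fin 2) ℂ) i j).re -
            ((fundamentalRep (Fin 2) (b e) : Matrix (Fin 2) (Fin 2) ℂ) i j).re) ^ 2 +
          (((fundamentalRep (Fin 2) (a e) : Matrix (Fin 2) (Fin 2) ℂ) i j).im -
            ((fundamentalRep (Fin 2) (b e) : Matrix (Fin 2) (Fin 2) ℂ) i j).im) ^ 2) := by
  refine Finset.sum_congr rfl fun e _ => ?_
  rw [hsForm_self]
  refine Finset.sum_congr rfl fun i _ => Finset.sum_congr rfl fun j _ => ?_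
  rw [Matrix.sub_apply, Complex.sq_norm, Complex.normSq_apply, Complex.sub_re, Complex.sub_im]
  ring

/-- **Second moment of the Hilbert–Schmidt increment along the regular SZZ flow**, uniformly in the start:
`E[Σ_e ‖ρ(U^x_v e) − ρ(U^x_u e)‖_F²] ≤ C((v−u)² + (v−u))` with `C = C(L, β)`, for every probability space, every solution
family with the progressive clause of `exists_regularFlow`, every start `x` and `u ≤ v`.
[cite: RevuzYor1999, Ch. IV Thm (2.2) (isometry); Ch. IX Def. (1.2)] -/
theorem integral_hsDist_le_flow (L : ℕ) [NeZero L] (β : ℝ) :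
    ∃ C : ℝ, 0 ≤ C ∧ ∀ {Ω : Type} [MeasurableSpace Ω] {P : Measure Ω} [IsProbabilityMeasure P]
      {W : ℝ≥0 → Ω → (Edge 3 L × NoiseIdx 2 → ℝ)} (hW : IsFlatBrownian W P)
      (U : GaugeConfig 3 L (Matrix.specialUnitaryGroup (Fin 2) ℂ) → ℝ≥0 → Ω →
        GaugeConfig 3 L (Matrix.specialUnitaryGroup (Fin 2) ℂ))
      (_hU : ∀ x, (∀ ω, U x 0 ω = x) ∧
        (latticeLangevinDynamics (fundamentalLatticeRep 2) β).IsSolution (fundamentalRep (Fin 2))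
          hW.natFiltration P W (U x))
      (_hUm : ∀ i : ℝ≥0, Measurable[@Prod.instMeasurableSpace (Set.Iic i)
          (GaugeConfig 3 L (Matrix.specialUnitaryGroup (Fin 2) ℂ) × Ω) inferInstance
          (@Prod.instMeasurableSpace (GaugeConfig 3 L (Matrix.specialUnitaryGroup (Fin 2) ℂ)) Ω inferInstance
            (hW.natFiltration i))]
        (fun q : Set.Iic i × (GaugeConfig 3 L (Matrix.specialUnitaryGroup (Fin 2) ℂ) × Ω) => U q.2.1 q.1 q.2.2))
      (x : GaugeConfig 3 L (Matrix.specialUnitaryGroup (Fin 2) ℂ)) (u v : ℝ≥0), u ≤ v →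
      Integrable (fun ω => ∑ e, hsForm 2
          ((fundamentalRep (Fin 2) (U x v ω e) : Matrix (Fin 2) (Fin 2) ℂ) - fundamentalRep (Fin 2) (U x u ω e))
          ((fundamentalRep (Fin 2) (U x v ω e) : Matrix (Fin 2) (Fin 2) ℂ) - fundamentalRep (Fin 2) (U x u ω e))) P ∧
      ∫ ω, ∑ e, hsForm 2
          ((fundamentalRep (Fin 2) (U x v ω e) : Matrix (Fin 2) (Fin 2) ℂ) - fundamentalRep (Fin 2) (U x u ω e))
          ((fundamentalRep (Fin 2) (U x v ω e) : Matrix (Fin 2) (Fin 2) ℂ) - fundamentalRep (Fin 2) (U x u ω e)) ∂P ≤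
        C * ((((v : ℝ) - u) ^ 2) + ((v : ℝ) - u)) := by
  classical
  obtain ⟨C, hC0, hC⟩ := integral_coordIncr_sq_le_flow L β
  refine ⟨(Fintype.card (Edge 3 L) : ℝ) * (8 * C), by positivity, ?_⟩
  intro Ω mΩ P hP W hW U hU hUm x u v huv
  set δ : ℝ := (((v : ℝ) - u) ^ 2) + ((v : ℝ) - u) with hδ
  -- each squared coordinate increment is integrable with integral ≤ C δ
  have hq : ∀ (e : Edge 3 L) (i j : Fin 2) (c : Bool),
      Integrable (fun ω => ((fun z : ℂ => if c then z.im else z.re)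
          ((fundamentalRep (Fin 2) (U x v ω e) : Matrix (Fin 2) (Fin 2) ℂ) i j) -
        (fun z : ℂ => if c then z.im else z.re)
          ((fundamentalRep (Fin 2) (U x u ω e) : Matrix (Fin 2) (Fin 2) ℂ) i j)) ^ 2) P ∧
      ∫ ω, ((fun z : ℂ => if c then z.im else z.re)
          ((fundamentalRep (Fin 2) (U x v ω e) : Matrix (Fin 2) (Fin 2) ℂ) i j) -
        (fun z : ℂ => if c then z.im else z.re)
          ((fundamentalRep (Fin 2) (U x u ω e) : Matrix (Fin 2) (Fin 2) ℂ) i j)) ^ 2 ∂P ≤ C * δ := by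
    intro e i j c
    obtain ⟨h4, h2⟩ := hC hW U hU hUm x e i j c u v huv
    exact ⟨(h4.mono_exponent (by norm_num : (2 : ℝ≥0∞) ≤ 4)).integrable_sq, h2⟩
  -- rewrite the «distance» as the sum of squared coordinates
  have hpt : ∀ ω, (∑ e, hsForm 2
      ((fundamentalRep (Fin 2) (U x v ω e) : Matrix (Fin 2) (Fin 2) ℂ) - fundamentalRep (Fin 2) (U x u ω e))
      ((fundamentalRep (Fin 2) (U x v ω e) : Matrix (Fin 2) (Fin 2) ℂ) - fundamentalRep (Fin 2) (U x u ω e))) =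
      ∑ e, ∑ i, ∑ j,
        (((fun z : ℂ => if false then z.im else z.re)
            ((fundamentalRep (Fin 2) (U x v ω e) : Matrix (Fin 2) (Fin 2) ℂ) i j) -
          (fun z : ℂ => if false then z.im else z.re)
            ((fundamentalRep (Fin 2) (U x u ω e) : Matrix (Fin 2) (Fin 2) ℂ) i j)) ^ 2 +
        ((fun z : ℂ => if true then z.im else z.re)
            ((fundamentalRep (Fin 2) (U x v ω e) : Matrix (Fin 2) (Fin 2) ℂ) i j) -
          (fun z : ℂ => if true then z.im else z.re)
            ((fundamentalRep (Fin 2) (U x u ω e) : Matrix (Fin 2) (Fin 2) ℂ) i j)) ^ 2) := by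
    intro ω
    rw [hsDist_eq_sum_coord_sq]
    simp only [Bool.false_eq_true, if_false, if_true]
  have hint_ij : ∀ (e : Edge 3 L) (i j : Fin 2), Integrable (fun ω =>
      (((fun z : ℂ => if false then z.im else z.re)
            ((fundamentalRep (Fin 2) (U x v ω e) : Matrix (Fin 2) (Fin 2) ℂ) i j) -
          (fun z : ℂ => if false then z.im else z.re)
            ((fundamentalRep (Fin 2) (U x u ω e) : Matrix (Fin 2) (Fin 2) ℂ) i j)) ^ 2 +
        ((fun z : ℂ => if true then z.im else z.re)
            ((fundamentalRep (Fin 2) (U x v ω e) : Matrix (Fin 2) (Fin 2) ℂ) i j) -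
          (fun z : ℂ => if true then z.im else z.re)
            ((fundamentalRep (Fin 2) (U x u ω e) : Matrix (Fin 2) (Fin 2) ℂ) i j)) ^ 2)) P :=
    fun e i j => (hq e i j false).1.add (hq e i j true).1
  have hint_i : ∀ (e : Edge 3 L) (i : Fin 2), Integrable (fun ω => ∑ j,
      ((((fun z : ℂ => if false then z.im else z.re)
            ((fundamentalRep (Fin 2) (U x v ω e) : Matrix (Fin 2) (Fin 2) ℂ) i j) -
          (fun z : ℂ => if false then z.im else z.re)
            ((fundamentalRep (Fin 2) (U x u ω e) : Matrix (Fin 2) (Fin 2) ℂ) i j)) ^ 2 +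
        ((fun z : ℂ => if true then z.im else z.re)
            ((fundamentalRep (Fin 2) (U x v ω e) : Matrix (Fin 2) (Fin 2) ℂ) i j) -
          (fun z : ℂ => if true then z.im else z.re)
            ((fundamentalRep (Fin 2) (U x u ω e) : Matrix (Fin 2) (Fin 2) ℂ) i j)) ^ 2))) P :=
    fun e i => integrable_finsetSum _ fun j _ => hint_ij e i j
  have hint_e : ∀ e : Edge 3 L, Integrable (fun ω => ∑ i, ∑ j,
      ((((fun z : ℂ => if false then z.im else z.re)
            ((fundamentalRep (Fin 2) (U x v ω e) : Matrix (Fin 2) (Fin 2) ℂ) i j) -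
          (fun z : ℂ => if false then z.im else z.re)
            ((fundamentalRep (Fin 2) (U x u ω e) : Matrix (Fin 2) (Fin 2) ℂ) i j)) ^ 2 +
        ((fun z : ℂ => if true then z.im else z.re)
            ((fundamentalRep (Fin 2) (U x v ω e) : Matrix (Fin 2) (Fin 2) ℂ) i j) -
          (fun z : ℂ => if true then z.im else z.re)
            ((fundamentalRep (Fin 2) (U x u ω e) : Matrix (Fin 2) (Fin 2) ℂ) i j)) ^ 2))) P :=
    fun e => integrable_finsetSum _ fun i _ => hint_i e i
  have hInt : Integrable (fun ω => ∑ e, hsForm 2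
      ((fundamentalRep (Fin 2) (U x v ω e) : Matrix (Fin 2) (Fin 2) ℂ) - fundamentalRep (Fin 2) (U x u ω e))
      ((fundamentalRep (Fin 2) (U x v ω e) : Matrix (Fin 2) (Fin 2) ℂ) - fundamentalRep (Fin 2) (U x u ω e))) P := by
    have h := integrable_finsetSum (Finset.univ : Finset (Edge 3 L)) fun e _ => hint_e e
    refine h.congr (ae_of_all _ fun ω => ?_)
    exact (hpt ω).symm
  refine ⟨hInt, ?_⟩
  -- integrate the sum termwise
  have hstep : (∫ ω, ∑ e, hsForm 2
      ((fundamentalRep (Fin 2) (U x v ω e) : Matrix (Fin 2) (Fin 2) ℂ) - fundamentalRep (Fin 2) (U x u ω e))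
      ((fundamentalRep (Fin 2) (U x v ω e) : Matrix (Fin 2) (Fin 2) ℂ) - fundamentalRep (Fin 2) (U x u ω e)) ∂P) =
      ∑ e, ∑ i, ∑ j, ((∫ ω, ((fun z : ℂ => if false then z.im else z.re)
            ((fundamentalRep (Fin 2) (U x v ω e) : Matrix (Fin 2) (Fin 2) ℂ) i j) -
          (fun z : ℂ => if false then z.im else z.re)
            ((fundamentalRep (Fin 2) (U x u ω e) : Matrix (Fin 2) (Fin 2) ℂ) i j)) ^ 2 ∂P) +
        ∫ ω, ((fun z : ℂ => if true then z.im else z.re)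
            ((fundamentalRep (Fin 2) (U x v ω e) : Matrix (Fin 2) (Fin 2) ℂ) i j) -
          (fun z : ℂ => if true then z.im else z.re)
            ((fundamentalRep (Fin 2) (U x u ω e) : Matrix (Fin 2) (Fin 2) ℂ) i j)) ^ 2 ∂P) := by
    rw [integral_congr_ae (ae_of_all _ hpt), integral_finsetSum _ fun e _ => hint_e e]
    refine Finset.sum_congr rfl fun e _ => ?_
    rw [integral_finsetSum _ fun i _ => hint_i e i]
    refine Finset.sum_congr rfl fun i _ => ?_
    rw [integral_finsetSum _ fun j _ => hint_ij e i j]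
    refine Finset.sum_congr rfl fun j _ => ?_
    exact integral_add (hq e i j false).1 (hq e i j true).1
  rw [hstep]
  calc ∑ e : Edge 3 L, ∑ i : Fin 2, ∑ j : Fin 2, ((∫ ω, ((fun z : ℂ => if false then z.im else z.re)
            ((fundamentalRep (Fin 2) (U x v ω e) : Matrix (Fin 2) (Fin 2) ℂ) i j) -
          (fun z : ℂ => if false then z.im else z.re)
            ((fundamentalRep (Fin 2) (U x u ω e) : Matrix (Fin 2) (Fin 2) ℂ) i j)) ^ 2 ∂P) +
        ∫ ω, ((fun z : ℂ => if true then z.im else z.re)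
            ((fundamentalRep (Fin 2) (U x v ω e) : Matrix (Fin 2) (Fin 2) ℂ) i j) -
          (fun z : ℂ => if true then z.im else z.re)
            ((fundamentalRep (Fin 2) (U x u ω e) : Matrix (Fin 2) (Fin 2) ℂ) i j)) ^ 2 ∂P)
      ≤ ∑ _e : Edge 3 L, ∑ _i : Fin 2, ∑ _j : Fin 2, (C * δ + C * δ) := by
        gcongr with e _ i _ j _
        · exact (hq e i j false).2
        · exact (hq e i j true).2
    _ = (Fintype.card (Edge 3 L) : ℝ) * (8 * C) * δ := by
        simp only [Finset.sum_const, Finset.card_univ, Fintype.card_fin, nsmul_eq_mul]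
        push_cast
        ring

/-- ★ **Stochastic continuity of the SZZ dynamics, uniformly in the start and in the realisation.**  There is
`C = C(L, β) ≥ 0` such that EVERY solution `U` of the SU(2) lattice Langevin system at coupling `β` from a deterministic
start `x`, on ANY probability space with any flat Brownian driver (raw natural filtration), satisfies
`E[Σ_e ‖ρ(U_h e) − ρ(x e)‖_F²] ≤ C(h² + h)` at every lattice time `h` (in particular `≤ 2C·h` for `h ≤ 1`).  Transfer of
`integral_hsDist_le_flow` from the regular flow on the product Wiener space by uniqueness in law (`lawUnique_of_start`).
[cite: RevuzYor1999, Ch. IX Thm (1.7)] -/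
theorem integral_hsDist_start_le (L : ℕ) [NeZero L] (β : ℝ) :
    ∃ C : ℝ, 0 ≤ C ∧ ∀ (x : GaugeConfig 3 L (Matrix.specialUnitaryGroup (Fin 2) ℂ))
      (Ω : Type) [MeasurableSpace Ω] (P : Measure Ω) [IsProbabilityMeasure P]
      (W : ℝ≥0 → Ω → (Edge 3 L × NoiseIdx 2 → ℝ)) (hW : IsFlatBrownian W P)
      (U : ℝ≥0 → Ω → GaugeConfig 3 L (Matrix.specialUnitaryGroup (Fin 2) ℂ)),
      (∀ ω, U 0 ω = x) →
      (latticeLangevinDynamics (fundamentalLatticeRep 2) β).IsSolution (fundamentalRep (Fin 2))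
        hW.natFiltration P W U →
      ∀ h : ℝ≥0,
        Integrable (fun ω => ∑ e, hsForm 2
          ((fundamentalRep (Fin 2) (U h ω e) : Matrix (Fin 2) (Fin 2) ℂ) - fundamentalRep (Fin 2) (x e))
          ((fundamentalRep (Fin 2) (U h ω e) : Matrix (Fin 2) (Fin 2) ℂ) - fundamentalRep (Fin 2) (x e))) P ∧
        ∫ ω, ∑ e, hsForm 2
          ((fundamentalRep (Fin 2) (U h ω e) : Matrix (Fin 2) (Fin 2) ℂ) - fundamentalRep (Fin 2) (x e))
          ((fundamentalRep (Fin 2) (U h ω e) : Matrix (Fin 2) (Fin 2) ℂ) - fundamentalRep (Fin 2) (x e)) ∂P ≤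
        C * (((h : ℝ) ^ 2) + h) := by
  classical
  obtain ⟨C, hC0, hC⟩ := integral_hsDist_le_flow L β
  refine ⟨C, hC0, ?_⟩
  intro x Ω mΩ P hP W hW U hU0 hU h
  haveI := secondCountableTopology_su2
  haveI := borelSpace_config L
  -- the regular flow on the product Wiener space
  haveI := isProbabilityMeasure_piWiener (Edge 3 L × NoiseIdx 2)
  have hWc := isFlatBrownian_piWiener 3 L (NoiseIdx 2)
  obtain ⟨X, -, hX, hXm, -, -, -⟩ := exists_regularFlow L β hWc
  obtain ⟨hIntX, hbdX⟩ := hC hWc X hX hXm x 0 h bot_le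
  -- the «distance to x» observable
  set f : GaugeConfig 3 L (Matrix.specialUnitaryGroup (Fin 2) ℂ) → ℝ := fun z => ∑ e, hsForm 2
      ((fundamentalRep (Fin 2) (z e) : Matrix (Fin 2) (Fin 2) ℂ) - fundamentalRep (Fin 2) (x e))
      ((fundamentalRep (Fin 2) (z e) : Matrix (Fin 2) (Fin 2) ℂ) - fundamentalRep (Fin 2) (x e)) with hf
  have hfc : Continuous f := continuous_hsDist continuous_id continuous_const
  have hfm : AEStronglyMeasurable f (P.map (U h)) := hfc.measurable.aestronglyMeasurable
  have hmU : Measurable (U h) := (hU.adapted h).mono (hW.natFiltration.le h) le_rfl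
  have hmX : Measurable (X x h) := ((hX x).2.adapted h).mono (hWc.natFiltration.le h) le_rfl
  have hlaw := lawUnique_of_start β x hW hWc hU0 hU (hX x).1 (hX x).2 h
  have hX0 : ∀ ω, X x 0 ω = x := (hX x).1
  -- the flow statement read at `u = 0`
  have hIntX' : Integrable (fun ω => f (X x h ω)) (Measure.pi fun _ : Edge 3 L × NoiseIdx 2 => preWienerMeasure) := by
    refine hIntX.congr (ae_of_all _ fun ω => ?_)
    simp only [hf, hX0 ω]
  have hbdX' : ∫ ω, f (X x h ω) ∂(Measure.pi fun _ : Edge 3 L × NoiseIdx 2 => preWienerMeasure) ≤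
      C * (((h : ℝ) ^ 2) + h) := by
    have h1 : (∫ ω, f (X x h ω) ∂(Measure.pi fun _ : Edge 3 L × NoiseIdx 2 => preWienerMeasure)) =
        ∫ ω, ∑ e, hsForm 2
          ((fundamentalRep (Fin 2) (X x h ω e) : Matrix (Fin 2) (Fin 2) ℂ) - fundamentalRep (Fin 2) (X x 0 ω e))
          ((fundamentalRep (Fin 2) (X x h ω e) : Matrix (Fin 2) (Fin 2) ℂ) - fundamentalRep (Fin 2) (X x 0 ω e))
          ∂(Measure.pi fun _ : Edge 3 L × NoiseIdx 2 => preWienerMeasure) :=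
      integral_congr_ae (ae_of_all _ fun ω => by simp only [hf, hX0 ω])
    rw [h1]
    simpa using hbdX
  -- transport through the common law
  have hIf : Integrable f (P.map (U h)) := by
    rw [hlaw]
    exact (integrable_map_measure hfc.measurable.aestronglyMeasurable hmX.aemeasurable).mpr hIntX'
  refine ⟨?_, ?_⟩
  · exact (integrable_map_measure hfm hmU.aemeasurable).mp hIf
  · show (∫ ω, f (U h ω) ∂P) ≤ C * (((h : ℝ) ^ 2) + h)
    rw [← integral_map hmU.aemeasurable hfm, hlaw, integral_map hmX.aemeasurable hfc.measurable.aestronglyMeasurable]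
    exact hbdX'

/-- **Uniform-in-start stochastic continuity of the SZZ transition laws, tail form** (Markov's inequality on
`integral_hsDist_start_le`): `P(Σ_e ‖ρ(U_h e) − ρ(x e)‖_F² ≥ r) ≤ C(h² + h)/r` for every solution from the deterministic start
`x` on any space, every `h` and `r > 0`, with `C = C(L, β)`. [cite: RevuzYor1999, Ch. IX Thm (1.7)] -/
theorem measureReal_hsDist_start_ge_le (L : ℕ) [NeZero L] (β : ℝ) :
    ∃ C : ℝ, 0 ≤ C ∧ ∀ (x : GaugeConfig 3 L (Matrix.specialUnitaryGroup (Fin 2) ℂ))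
      (Ω : Type) [MeasurableSpace Ω] (P : Measure Ω) [IsProbabilityMeasure P]
      (W : ℝ≥0 → Ω → (Edge 3 L × NoiseIdx 2 → ℝ)) (hW : IsFlatBrownian W P)
      (U : ℝ≥0 → Ω → GaugeConfig 3 L (Matrix.specialUnitaryGroup (Fin 2) ℂ)),
      (∀ ω, U 0 ω = x) →
      (latticeLangevinDynamics (fundamentalLatticeRep 2) β).IsSolution (fundamentalRep (Fin 2))
        hW.natFiltration P W U →
      ∀ (h : ℝ≥0) (r : ℝ), 0 < r →
        P.real {ω | r ≤ ∑ e, hsForm 2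
          ((fundamentalRep (Fin 2) (U h ω e) : Matrix (Fin 2) (Fin 2) ℂ) - fundamentalRep (Fin 2) (x e))
          ((fundamentalRep (Fin 2) (U h ω e) : Matrix (Fin 2) (Fin 2) ℂ) - fundamentalRep (Fin 2) (x e))} ≤
        C * (((h : ℝ) ^ 2) + h) / r := by
  obtain ⟨C, hC0, hC⟩ := integral_hsDist_start_le L β
  refine ⟨C, hC0, ?_⟩
  intro x Ω mΩ P hP W hW U hU0 hU h r hr
  obtain ⟨hInt, hbd⟩ := hC x Ω P W hW U hU0 hU h
  have hnn : 0 ≤ᵐ[P] fun ω => ∑ e, hsForm 2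
      ((fundamentalRep (Fin 2) (U h ω e) : Matrix (Fin 2) (Fin 2) ℂ) - fundamentalRep (Fin 2) (x e))
      ((fundamentalRep (Fin 2) (U h ω e) : Matrix (Fin 2) (Fin 2) ℂ) - fundamentalRep (Fin 2) (x e)) :=
    ae_of_all _ fun ω => hsDist_nonneg _ _
  have hmk := mul_meas_ge_le_integral_of_nonneg hnn hInt r
  rw [le_div_iff₀ hr, mul_comm]
  exact hmk.trans hbd

end Summit.QuantumFields.YangMills.Theorems.ColdStartUniversality

end
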